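import Mathlib
import Summits.KontsevichZagierPeriods.KontsevichZagierPeriods.Theorems.SoloInformedDefMoveNewtonLeibnizI
import Summits.KontsevichZagierPeriods.KontsevichZagierPeriods.Theorems.SoloInformedDefMoveChangeOfVariables
import HarnessLib

/-!
# Solo-informed (A390-ii): generator definability for ARBITRARY chains, IV — the
change-of-variables move (2)

File F6j.  Conditional on the Lion–Rolin preparation fact, every (unbounded) change-of-variables
move `[r] − [r'] ∈ KZOver.changeOfVariablesRel ℝ` satisfies the definability invariant
`SoloInformedDefinableRelI` (`soloInformed_definableRelI_changeOfVariablesRel`).  The clauses are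
those of `SoloInformedDefMoveChangeOfVariables` (functional map term, injectivity, image,
differentiability-with-Jacobian — all first order); admissibility of `r, r'` is I-admissibility.

References: [cite: KontsevichZagier2001, §1.2 rule (2)]; [cite: BochnakCosteRoy1998, Prop. 2.9.1];
[cite: ComteLionRolin2000, Thm. 3].
-/

noncomputable section

open Set MeasureTheory Literature.ModelTheory.ExponentialFields
  Literature.NumberTheory.Transcendental

namespace Summit.KontsevichZagierPeriods.KontsevichZagierPeriods.Theorems

namespace SoloInformedPMap

variable {K : Type} {n : ℕ}

/-- **From the clauses to the data of move (2)**, I-denoted representations: at a good parameter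
the map term `Φ := M.mval p` carries a derivative family with the Jacobian identity, is injective
on `dom (T.repI p)` and maps it onto `dom (T'.repI p)`. [cite: KontsevichZagier2001, §1.2 rule (2)] -/
theorem cov_sideI {M : SoloInformedPMap K n n} {T T' : SoloInformedPTerm K n} {p : K → ℝ}
    (hT : T.SoloInformedAdmI p) (hT' : T'.SoloInformedAdmI p) (hM : M.SoloInformedMapFunctional p)
    (hMT : M.fibre p = T.fibre p) (hinj : M.SoloInformedInjClause p)
    (himg : M.SoloInformedImgClause T' p) (hdiff : M.SoloInformedDiffClause T T' p) :
    ∃ Φ' : (Fin n → ℝ) → (Fin n → ℝ) →L[ℝ] (Fin n → ℝ),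
      (∀ x ∈ (T.repI p).domain, HasFDerivWithinAt (M.mval p) (Φ' x) (T.repI p).domain x) ∧
      InjOn (M.mval p) (T.repI p).domain ∧
      (T'.repI p).domain = M.mval p '' (T.repI p).domain ∧
      (∀ x ∈ (T.repI p).domain,
        (T.repI p).integrand x = (T'.repI p).integrand (M.mval p x) * |(Φ' x).det|) ∧
      M.fibre p = (T.repI p).domain := by
  classical
  have hD : M.fibre p = (T.repI p).domain := by rw [hMT, SoloInformedPTerm.repI_domain hT]
  have hG : ∀ x ∈ M.fibre p, ∀ y, Fin.append x y ∈ M.gfibre p ↔ y = M.mval p x :=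
    fun x hx y => append_mem_gfibre_iff hM hx y
  have hgT : ∀ x ∈ M.fibre p, ∀ t, Fin.snoc x t ∈ T.gfibre p ↔ t = (T.repI p).integrand x :=
    fun x hx t => SoloInformedPTerm.snoc_mem_gfibre_iff_of_admI hT (hMT ▸ hx) t
  have hgT' : ∀ y ∈ T'.fibre p, ∀ t,
      Fin.snoc y t ∈ T'.gfibre p ↔ t = (T'.repI p).integrand y :=
    fun y hy t => SoloInformedPTerm.snoc_mem_gfibre_iff_of_admI hT' hy t
  have hinj' : InjOn (M.mval p) (M.fibre p) := (injClause_iff hG).1 hinj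
  have himg' : T'.fibre p = M.mval p '' M.fibre p := (imgClause_iff (T' := T') hG).1 himg
  have hΦ : ∀ x ∈ M.fibre p, M.mval p x ∈ T'.fibre p := fun x hx => by
    rw [himg']
    exact mem_image_of_mem _ hx
  have hdiff' := (diffClause_iff hG hgT hgT' hΦ).1 hdiff
  choose L hL using hdiff'
  refine ⟨fun x => if hx : x ∈ M.fibre p then
    LinearMap.toContinuousLinearMap (Matrix.toLin' (L x hx)) else 0, ?_, ?_, ?_, ?_, hD⟩
  · rw [← hD]
    intro x hx
    simp only [dif_pos hx]
    exact (hL x hx).2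
  · rw [← hD]
    exact hinj'
  · rw [← hD, SoloInformedPTerm.repI_domain hT']
    exact himg'
  · rw [← hD]
    intro x hx
    simp only [dif_pos hx, soloInformed_det_toContinuousLinearMap_toLin']
    exact (hL x hx).1

end SoloInformedPMap

/-! ### The move -/

/-- From base-change equations and the (2) side conditions on the real representations to
membership in `KZOver.changeOfVariablesRel k`. [cite: KontsevichZagier2001, §1.2 rule (2)] -/
theorem soloInformed_mem_changeOfVariablesRel_of_baseChange {k : Type*} [Field k]
    [Algebra k ℝ] {n : ℕ} {x y : KZOver.IntegralRep k n} {A A' : KZOver.IntegralRep ℝ n}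
    (hx : x.baseChange ℝ = A) (hy : y.baseChange ℝ = A')
    {Φ : (Fin n → ℝ) → (Fin n → ℝ)} {Φ' : (Fin n → ℝ) → (Fin n → ℝ) →L[ℝ] (Fin n → ℝ)}
    (hΦ : IsSemialgebraicMapOn k A.domain Φ)
    (hder : ∀ x ∈ A.domain, HasFDerivWithinAt Φ (Φ' x) A.domain x) (hinj : InjOn Φ A.domain)
    (hdom : A'.domain = Φ '' A.domain)
    (hjac : ∀ x ∈ A.domain, A.integrand x = A'.integrand (Φ x) * |(Φ' x).det|) :
    KZOver.of x - KZOver.of y ∈ KZOver.changeOfVariablesRel k := by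
  subst hx hy
  exact ⟨n, x, y, Φ, Φ', hΦ, hder, hinj, hdom, hjac, rfl⟩

/-- **Definability of the change-of-variables move (2), arbitrary representations** (conditional
on the preparation fact). [cite: KontsevichZagier2001, §1.2 rule (2)] -/
theorem soloInformed_definableRelI_of_mem_changeOfVariablesRel (hprep : semialgebraicPreparation)
    {c : KZOver.FormalRep ℝ} (hc : c ∈ KZOver.changeOfVariablesRel ℝ) :
    SoloInformedDefinableRelI c := by
  classical
  obtain ⟨n, r, r', Φ, Φ', hΦ, hder, hinj, hdom, hjac, rfl⟩ := hc
  obtain ⟨K₀, _, T₀, p₀, hA₀, hrep₀, -⟩ := soloInformed_exists_pterm_repI r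
  obtain ⟨K₁, _, T₁, p₁, hA₁, hrep₁, -⟩ := soloInformed_exists_pterm_repI r'
  obtain ⟨K₂, _, M₀, p₂, hMf₀, hMfib₀, hMg₀, -⟩ :=
    soloInformed_exists_pmap_of_mapOn r.isSemialgebraic_domain hΦ
  -- common parameter space
  let θ₀ : K₀ → (K₀ ⊕ K₁) ⊕ K₂ := fun i => Sum.inl (Sum.inl i)
  let θ₁ : K₁ → (K₀ ⊕ K₁) ⊕ K₂ := fun i => Sum.inl (Sum.inr i)
  let θ₂ : K₂ → (K₀ ⊕ K₁) ⊕ K₂ := Sum.inr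
  let T := T₀.pullback θ₀
  let T' := T₁.pullback θ₁
  let M := M₀.pullback θ₂
  let q : (K₀ ⊕ K₁) ⊕ K₂ → ℝ := Sum.elim (Sum.elim p₀ p₁) p₂
  have hq₀ : q ∘ θ₀ = p₀ := rfl
  have hq₁ : q ∘ θ₁ = p₁ := rfl
  have hq₂ : q ∘ θ₂ = p₂ := Sum.elim_comp_inr _ _
  have hTrep : ∀ p, T.repI p = T₀.repI (p ∘ θ₀) := fun p => SoloInformedPTerm.repI_pullback _ _ _
  have hT'rep : ∀ p, T'.repI p = T₁.repI (p ∘ θ₁) := fun p =>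
    SoloInformedPTerm.repI_pullback _ _ _
  have hTadm : ∀ p, T.SoloInformedAdmI p ↔ T₀.SoloInformedAdmI (p ∘ θ₀) := fun p =>
    SoloInformedPTerm.admI_pullback_iff _ _ _
  have hT'adm : ∀ p, T'.SoloInformedAdmI p ↔ T₁.SoloInformedAdmI (p ∘ θ₁) := fun p =>
    SoloInformedPTerm.admI_pullback_iff _ _ _
  have hMfun : ∀ p, M.SoloInformedMapFunctional p ↔ M₀.SoloInformedMapFunctional (p ∘ θ₂) :=
    fun p => SoloInformedPMap.mapFunctional_pullback_iff M₀ θ₂ p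
  have hMfib : ∀ p, M.fibre p = M₀.fibre (p ∘ θ₂) := fun p =>
    SoloInformedPMap.fibre_pullback M₀ θ₂ p
  have hMgf : ∀ p, M.gfibre p = M₀.gfibre (p ∘ θ₂) := fun p =>
    SoloInformedPMap.gfibre_pullback M₀ θ₂ p
  -- the good set
  let V : Set ((K₀ ⊕ K₁) ⊕ K₂ → ℝ) := {p | T.SoloInformedAdmI p ∧ T'.SoloInformedAdmI p ∧
    M.SoloInformedMapFunctional p ∧ M.fibre p = T.fibre p ∧ M.SoloInformedInjClause p ∧
    M.SoloInformedImgClause T' p ∧ M.SoloInformedDiffClause T T' p}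
  have hV : IsSemialgebraic ℚ V :=
    soloInformed_isSemialgebraic_setOf_and (T.isSemialgebraic_setOf_admI hprep)
    (soloInformed_isSemialgebraic_setOf_and (T'.isSemialgebraic_setOf_admI hprep)
    (soloInformed_isSemialgebraic_setOf_and M.isSemialgebraic_setOf_mapFunctional
    (soloInformed_isSemialgebraic_setOf_and (M.isSemialgebraic_setOf_fibre_eq_fibre T)
    (soloInformed_isSemialgebraic_setOf_and M.isSemialgebraic_setOf_injClause
    (soloInformed_isSemialgebraic_setOf_and (M.isSemialgebraic_setOf_imgClause T')
    (M.isSemialgebraic_setOf_diffClause T T'))))))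
  refine ⟨(K₀ ⊕ K₁) ⊕ K₂, inferInstance, SoloInformedPCombo.twoTerm T T', q, V, hV,
    ?_, ?_, ?_, ?_⟩
  · -- the original parameter is good
    have hT : T.SoloInformedAdmI q := (hTadm q).2 (hq₀ ▸ hA₀)
    have hT' : T'.SoloInformedAdmI q := (hT'adm q).2 (hq₁ ▸ hA₁)
    have hM : M.SoloInformedMapFunctional q := (hMfun q).2 (hq₂ ▸ hMf₀)
    have hTq : T.repI q = r := by rw [hTrep, hq₀, hrep₀]
    have hT'q : T'.repI q = r' := by rw [hT'rep, hq₁, hrep₁]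
    have hfT : T.fibre q = r.domain := by rw [← SoloInformedPTerm.repI_domain hT, hTq]
    have hfT' : T'.fibre q = r'.domain := by rw [← SoloInformedPTerm.repI_domain hT', hT'q]
    have hfM : M.fibre q = r.domain := by rw [hMfib, hq₂, hMfib₀]
    have hG : ∀ x ∈ M.fibre q, ∀ y, Fin.append x y ∈ M.gfibre q ↔ y = Φ x := fun x hx y => by
      rw [hMgf, hq₂]
      exact hMg₀ x (hfM ▸ hx) y
    have hgT : ∀ x ∈ M.fibre q, ∀ t, Fin.snoc x t ∈ T.gfibre q ↔ t = r.integrand x :=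
      fun x hx t => by
        rw [SoloInformedPTerm.snoc_mem_gfibre_iff_of_admI hT (by rw [hfT, ← hfM]; exact hx), hTq]
    have hgT' : ∀ y ∈ T'.fibre q, ∀ t, Fin.snoc y t ∈ T'.gfibre q ↔ t = r'.integrand y :=
      fun y hy t => by rw [SoloInformedPTerm.snoc_mem_gfibre_iff_of_admI hT' hy, hT'q]
    have hΦT' : ∀ x ∈ M.fibre q, Φ x ∈ T'.fibre q := fun x hx => by
      rw [hfT', hdom]
      exact mem_image_of_mem Φ (hfM ▸ hx)
    refine ⟨hT, hT', hM, hfM.trans hfT.symm, ?_, ?_, ?_⟩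
    · rw [SoloInformedPMap.injClause_iff hG, hfM]
      exact hinj
    · rw [SoloInformedPMap.imgClause_iff (T' := T') hG, hfT', hfM]
      exact hdom
    · rw [SoloInformedPMap.diffClause_iff hG hgT hgT' hΦT', hfM]
      intro x hx
      have hclm : LinearMap.toContinuousLinearMap (Matrix.toLin' (LinearMap.toMatrix'
          ((Φ' x : (Fin n → ℝ) →L[ℝ] (Fin n → ℝ)) : (Fin n → ℝ) →ₗ[ℝ] (Fin n → ℝ)))) = Φ' x := by
        ext1 v
        rw [LinearMap.coe_toContinuousLinearMap', Matrix.toLin'_toMatrix']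
        rfl
      refine ⟨LinearMap.toMatrix' ((Φ' x : (Fin n → ℝ) →L[ℝ] (Fin n → ℝ)) :
        (Fin n → ℝ) →ₗ[ℝ] (Fin n → ℝ)), ?_, ?_⟩
      · rw [LinearMap.det_toMatrix']
        exact hjac x hx
      · rw [hclm]
        exact hder x hx
  · -- it denotes `c`
    rw [SoloInformedPCombo.comboI_twoTerm, hTrep, hT'rep, hq₀, hq₁, hrep₀, hrep₁]
  · -- every good parameter denotes a (2) move over `ℝ`
    rintro p ⟨hT, hT', hM, hMT, hinj', himg', hdiff'⟩
    obtain ⟨Ψ, hd, hi, hdo, hj, hD⟩ :=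
      SoloInformedPMap.cov_sideI hT hT' hM hMT hinj' himg' hdiff'
    refine ⟨SoloInformedPCombo.admI_twoTerm hT hT', ?_⟩
    rw [SoloInformedPCombo.comboI_twoTerm]
    exact KZOver.changeOfVariablesRel_subset_relations
      (soloInformed_mem_changeOfVariablesRel_of_baseChange (soloInformed_baseChange_real _)
        (soloInformed_baseChange_real _) (hD ▸ SoloInformedPMap.isSemialgebraicMapOn_mval hM)
        hd hi hdo hj)
  · -- rational lift at parameters with rational fibres
    rintro p ⟨hT, hT', hM, hMT, hinj', himg', hdiff'⟩ hRF
    obtain ⟨Ψ, hd, hi, hdo, hj, hD⟩ :=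
      SoloInformedPMap.cov_sideI hT hT' hM hMT hinj' himg' hdiff'
    obtain ⟨hS₀, hG₀⟩ := soloInformedRatFibres.fibre hRF T
    obtain ⟨hS₁, hG₁⟩ := soloInformedRatFibres.fibre hRF T'
    obtain ⟨hS₂, hG₂⟩ := M.ratFibres_fibre p hRF
    refine SoloInformedPCombo.ratLiftI_twoTerm (SoloInformedPTerm.ratRepI hS₀ hG₀ hT)
      (SoloInformedPTerm.ratRepI hS₁ hG₁ hT') (SoloInformedPTerm.baseChange_ratRepI _ _ _)
      (SoloInformedPTerm.baseChange_ratRepI _ _ _) ?_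
    exact KZOver.changeOfVariablesRel_subset_relations
      (soloInformed_mem_changeOfVariablesRel_of_baseChange
        (SoloInformedPTerm.baseChange_ratRepI _ _ _) (SoloInformedPTerm.baseChange_ratRepI _ _ _)
        (hD ▸ SoloInformedPMap.isSemialgebraicMapOn_mval_of hS₂ hG₂ hM) hd hi hdo hj)

/-- **The (2) hypothesis of THEOREM R / T for arbitrary chains, discharged** (conditional on the
preparation fact). [cite: KontsevichZagier2001, §1.2] -/
theorem soloInformed_definableRelI_changeOfVariablesRel (hprep : semialgebraicPreparation) :
    ∀ c ∈ KZOver.changeOfVariablesRel ℝ, SoloInformedDefinableRelI c :=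
  fun _ hc => soloInformed_definableRelI_of_mem_changeOfVariablesRel hprep hc

end Summit.KontsevichZagierPeriods.KontsevichZagierPeriods.Theorems
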